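import Summits.HubbardSuperconductivity.HubbardSuperconductivity.Theses.InfiniteVolumeFirst
import Summits.HubbardSuperconductivity.HubbardSuperconductivity.Theorems.BalabanIRBirEveryGroundStateSchur
import Literature.MathematicalPhysics.QuantumLattice.PairFieldMomentum

/-!
# Crux `NoNormalLimitState` (stmt-HubbardSuperconductivity-18533, route InfiniteVolumeFirst) —
# line `window-gap-transfer` (crux-strategist, 2026-08-17)

TRANSFER of the sibling step `KacWindowPenalty.WindowGap ⇒ every sector ground state has window
pair weight` (sandwich, `Theorems/KacWindowPenaltySandwich.lean`) to the infinite-volume-first crux.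

What replaces the structure the sibling needs and we lack. On the finite torus at one `(U,δ)`
(route KacWindowPenalty) the window pair weight of every ground state must be turned into
ZERO-MOMENTUM order at the SAME `L`, which needs the tail / infrared crux `WindowInfraredBound`
(stmt-1089) or an `O(1)`-resolution phase-stiffness input (the twist obstruction: Koma–Tasaki;
`Cruxes/WcbcsSsbToTorusLRO/STRATEGY-CENSUS.md` Transfer item 4). Here the volume limit is taken
BEFORE the window shrinks: a window-weight floor `a` valid for EVERY `ε > 0` (eventually in `L`,
threshold `L₀(ε)` free) already forces the Bochner atom `≥ a` of every pointwise limit of the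
translation-averaged pair correlations, by the LOWER Fejér bound
`R⁻⁴ Σ_{x,y∈[0,R)²} C_L(x−y) = L⁻² Σ_m F_R(q_m) S_L(m) ≥ (1 − R²ε²/2) · L⁻² Σ_{|q_m|≤ε} S_L(m)`
(`stub_windowFloorAtom`, provable now) — no tail bound, no stiffness at `O(1)` resolution.
So the crux is reduced to ONE energy-density statement, `stub_windowGapCofinal`: at one doping and
cofinally small `U`, the sector ground-state energy of `H_U + λ W_ε` exceeds that of `H_U` by
`λ a L²` with `a` INDEPENDENT of `ε` (and `λ = λ(ε)`, `L₀ = L₀(ε, U)` free) — the one-sided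
derivative `∂_λ e(λ; ε)|_{0⁺} ≥ a` of the penalised ground-state energy density, uniformly in the
Kac range `1/ε`. This is the output interface to ask of a `T = 0` weak-coupling construction
(engine "E2" of `Cruxes/WindowGap/STRATEGY-CENSUS.md`), in its weakest form among the five dresses
of that core (1088, 1892, 2009/2010, 10970, 18533): first order in the source, energy DENSITY
resolution, no infrared input.

Composition `NoNormalLimitState_of : stub_windowGapCofinal → stub_windowFloorAtom → NoNormalLimitState`
is kernel-checked below (chord/sandwich inequality `chord_div_le_re_expect_of_eigen` + the window
identity `Re⟨ψ, W_ε ψ⟩ = Σ_{|q_m|≤ε} S_ψ(m)`).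

Honours (Disproof.lean for this crux does not exist yet; disproof_path absent 2026-08-17): the
landed sibling negatives — `U > 0` load-bearing (free gas: window weight `κε²`, no floor; tree
`FreeFermiGasNoPairFieldLRO`, KacWindowPenalty p118873), `λ` must follow `ε` (`λ = O(ε²)`, twist
ceiling p105948: the stub has `∀ ε ∃ λ`), no `U`-uniform floor (`a = a(U)`, chosen after `U`:
`LowEnergyRigidity/Negative/NoUniformFloorNearZeroCoupling`, `HubbardPairDensityCouplingFloor`).
-/

noncomputable section

-- the mandated namespace repeats `HubbardSuperconductivity` (single-problem summit, D-0017)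
set_option linter.dupNamespace false

namespace Summit.HubbardSuperconductivity.HubbardSuperconductivity.Cruxes.NoNormalLimitState.WindowGapTransfer

open Literature.MathematicalPhysics.QuantumLattice Literature.Probability.LatticeModels Matrix Finset
  Filter
open Summit.HubbardSuperconductivity.HubbardSuperconductivity.Theorems (chord_div_le_re_expect_of_eigen)
open scoped ComplexConjugate ComplexOrder Topology

/-! ### Stub 1 (the crux of the line; open-problem strength) -/

/-- **Stub `windowGapCofinal` — ε-UNIFORM KAC-WINDOW GAP AT COFINALLY WEAK COUPLING.**
There is a hole doping `δ ∈ (0,1/2)` such that for every `U₀ > 0` some `U ∈ (0,U₀)` and some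
`a > 0` have: for every window radius `ε > 0` there are a penalty strength `λ > 0` and a threshold
`L₀` with, for all even `L ≥ L₀`,
`minEnergyOn (H_L + λ W_ε) K_L − minEnergyOn H_L K_L ≥ λ a L²`,
`H_L = hubbardTorus 2 L 1 U`, `K_L = szSector N_L 0`, `N_L = 2⌊(1−δ)L²/2⌋`,
`W_ε = Σ_{|q_m| ≤ ε} L⁻² Δ_d(m)ᴴ Δ_d(m)` the Kac-window d-wave pair penalty of route KacWindowPenalty
(`Δ_d(m) = pairFieldAt dWaveFormFactor L m`). Equivalently (concavity in `λ`): the right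
derivative at `0⁺` of the penalised sector ground-state energy density is `≥ a` for every `ε`,
i.e. every state within energy density `o(λ)` of the ground energy keeps window pair weight `≥ a`
per site. Physically `a ≈ ½ × (d-wave ODLRO density) ~ e^{−2/(αρU²)}`, `λ(ε) ≲ min(e_cond/a, ρ_s ε²/a)`
(normal state / twisted condensates of winding `> εL/2π` are the binding competitors),
`L₀ ≳ ξ(U) = e^{c/U²}`. Sibling: `KacWindowPenalty.WindowGap` (stmt-1088: one `(U,δ)`, `a = a(ε)`
allowed there because the tail crux 1089 is available; here `a` must not depend on `ε`, `U` is
cofinally small, and no tail is needed). Why it might fail: only if the weak-coupling ground state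
at every B1g-dominant doping is NOT a rigid `d_{x²−y²}` condensate (Kohn–Luttinger wrong at t'=0),
or coexists at every small `U` with an energy-density-degenerate orderless phase.
Sources: RaghuKivelsonScalapino2010 (arXiv:1002.0591) Fig. 2; ArovasBergKivelsonRaghu2022 §5.1;
WangEtAl2024 (arXiv:2310.05844) §II (sandwich); KomaTasaki1994 §2. -/
theorem stub_windowGapCofinal :
    ∃ δ ∈ Set.Ioo (0:ℝ) (1 / 2), ∀ U₀ : ℝ, 0 < U₀ → ∃ U ∈ Set.Ioo (0:ℝ) U₀, ∃ a : ℝ, 0 < a ∧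
      ∀ ε : ℝ, 0 < ε → ∃ lam : ℝ, 0 < lam ∧ ∃ L₀ : ℕ, ∀ (L : ℕ) [NeZero L], Even L → L₀ ≤ L →
        lam * a * (L : ℝ) ^ 2 ≤
          (hubbardTorus 2 L 1 U + (lam : ℂ) • ∑ m : TorusSite 2 L,
              if momentumNormSq L m ≤ ε ^ 2 then
                ((L : ℂ) ^ 2)⁻¹ •
                  ((pairFieldAt dWaveFormFactor L m)ᴴ * pairFieldAt dWaveFormFactor L m)
              else 0).minEnergyOn (szSector (2 * ⌊(1 - δ) * (L : ℝ) ^ 2 / 2⌋₊) 0) -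
            (hubbardTorus 2 L 1 U).minEnergyOn (szSector (2 * ⌊(1 - δ) * (L : ℝ) ^ 2 / 2⌋₊) 0) := by
  sorry

/-! ### Stub 2 (harmonic analysis on `(ℤ/Lℤ)²`, no Hamiltonian; provable now) -/

/-- **Stub `windowFloorAtom` — WINDOW FLOORS AT EVERY SCALE FORCE THE ATOM (lower Fejér bound).**
For any family `ψ` of torus Fock vectors normalised at even sides and any `a > 0`: if for every
`ε > 0` the window pair weight satisfies `Σ_{|q_m| ≤ ε} S_{ψ_L}(m) ≥ a L²` for all large even `L`
(threshold depending on `ε`), then every pointwise limit `C` of the translation-averaged d-wave pair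
correlations along a strictly increasing sequence of even sides has
`liminf_R R⁻⁴ Σ_{x,y ∈ [0,R)²} C(x − y) ≥ a`.
Proof sketch (≈ 300 lines): `Σ_{x,y∈[0,R)²} C_L(x−y) = L⁻² Σ_a ‖B_aψ_L‖²`
(`tightnessExchange_boxSum_eq`), block Plancherel `L² Σ_a‖B_aψ‖² = Σ_m |F_R(m)|² ‖Δ_d(m)ψ‖²`
(as in `WcbcsSsbToTorusLRO.stub_fejerClosure`, whose `block_plancherel` is private: re-derive),
the NEW kernel lower bound `|F_R(m)|² ≥ R⁴ (1 − R² |q_m|²/2)` (`cos θ ≥ 1 − θ²/2` termwise in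
`|Σ_{v<R} e^{ivt}|² = Σ_{v,w} cos((v−w)t)`, then the product of the two coordinates with both
factors in `[0,R²]`), drop the nonnegative off-window modes:
`R⁻⁴ Σ_{x,y∈[0,R)²} C_L(x−y) ≥ (1 − R²ε²/2) L⁻² Σ_{|q_m|≤ε} S_L(m) ≥ (1 − R²ε²/2) a`; let `j → ∞`
(finite sums of pointwise limits), then `ε → 0`: the `R`-th term is `≥ a` for every `R ≥ 1`;
`liminf ≥ a` (`|C| ≤ C_d²` bounds the sequence, `tightnessExchange_abs_corrAvg_le`).
Kennedy–Lieb–Shastry, PRL 61 (1988) 2582; Friedli–Velenik (2017) §10.4; Stein–Shakarchi Ch. 2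
(Fejér kernel). [folklore] -/
theorem stub_windowFloorAtom :
    ∀ (ψ : ∀ L, Fock (Orb (FermionTorus 2 L))) (a : ℝ), 0 < a →
      (∀ L, Even L → star (ψ L) ⬝ᵥ ψ L = 1) →
      (∀ ε : ℝ, 0 < ε → ∃ L₀ : ℕ, ∀ (L : ℕ) [NeZero L], Even L → L₀ ≤ L →
        a * (L : ℝ) ^ 2 ≤ ∑ m : TorusSite 2 L,
          if momentumNormSq L m ≤ ε ^ 2 then pairStructureFactor dWaveFormFactor L (ψ L) m else 0) →
      ∀ (Ls : ℕ → ℕ) (C : Site 2 → ℝ), StrictMono Ls → (∀ j, Even (Ls j)) →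
        (∀ x : Site 2, Tendsto (fun j : ℕ => (∑ y ∈ halfOpenBox 2 (Ls j),
          torusPullback (pairFieldCorr dWaveFormFactor ψ) (Ls j) (x + y) y) / ((Ls j : ℕ) : ℝ) ^ 2)
          atTop (𝓝 (C x))) →
        a ≤ liminf (fun R : ℕ => (∑ x ∈ halfOpenBox 2 R, ∑ y ∈ halfOpenBox 2 R, C (x - y)) /
          ((R : ℕ) : ℝ) ^ 4) atTop := by
  sorry

/-! ### Glue (proved): the window identity and the composition -/

/-- **The window penalty in a state**: `Re⟨ψ, W_ε ψ⟩ = Σ_{|q_m| ≤ ε} S_ψ(m)` (verbatim the identity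
`KacWindowPenalty.re_expect_window` of `Theorems/KacWindowPenaltyTargetImpliesSummit.lean`,
re-derived here to keep this skeleton's import closure to one route file). [folklore] -/
theorem re_expect_window (L : ℕ) [NeZero L] (ε : ℝ) (ψ : Fock (Orb (FermionTorus 2 L))) :
    (star ψ ⬝ᵥ (∑ m : TorusSite 2 L, if momentumNormSq L m ≤ ε ^ 2 then
        ((L : ℂ) ^ 2)⁻¹ • ((pairFieldAt dWaveFormFactor L m)ᴴ * pairFieldAt dWaveFormFactor L m)
        else 0) *ᵥ ψ).re =
      ∑ m : TorusSite 2 L, if momentumNormSq L m ≤ ε ^ 2 then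
        pairStructureFactor dWaveFormFactor L ψ m else 0 := by
  rw [sum_mulVec, dotProduct_sum, Complex.re_sum]
  refine Finset.sum_congr rfl fun m _ => ?_
  split_ifs with hm
  · rw [smul_mulVec, dotProduct_smul, smul_eq_mul, ← star_mulVec_dotProduct_mulVec,
      pairStructureFactor_apply,
      show ((L : ℂ) ^ 2)⁻¹ = ((((L : ℝ) ^ 2)⁻¹ : ℝ) : ℂ) by push_cast; rfl, Complex.re_ofReal_mul,
      div_eq_inv_mul]
  · rw [zero_mulVec, dotProduct_zero, Complex.zero_re]

/-- **Every ground state keeps the window floor** (finite `L`; the transferred sandwich step of route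
KacWindowPenalty): if `λ a L² ≤ minEnergyOn (H_L + λW_ε) K − minEnergyOn H_L K` and `ψ` is a
normalised ground state of `H_L` in the sector `K = szSector N 0`, then `a L² ≤ Σ_{|q_m|≤ε} S_ψ(m)`.
Chord inequality `chord_div_le_re_expect_of_eigen` and `re_expect_window`.
Wang et al., arXiv:2310.05844, §II; Tasaki (2020) §2.1. [folklore] -/
theorem windowFloor_of_gap (L : ℕ) [NeZero L] (U : ℝ) {ε lam a : ℝ} (hlam : 0 < lam) (N : ℕ)
    {ψ : Fock (Orb (FermionTorus 2 L))} (hψ1 : star ψ ⬝ᵥ ψ = 1)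
    (hψ : IsGroundStateInSector (hubbardTorus 2 L 1 U) N 0 ψ)
    (hgap : lam * a * (L : ℝ) ^ 2 ≤
      (hubbardTorus 2 L 1 U + (lam : ℂ) • ∑ m : TorusSite 2 L, if momentumNormSq L m ≤ ε ^ 2 then
        ((L : ℂ) ^ 2)⁻¹ • ((pairFieldAt dWaveFormFactor L m)ᴴ * pairFieldAt dWaveFormFactor L m)
        else 0).minEnergyOn (szSector N 0) - (hubbardTorus 2 L 1 U).minEnergyOn (szSector N 0)) :
    a * (L : ℝ) ^ 2 ≤ ∑ m : TorusSite 2 L,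
      if momentumNormSq L m ≤ ε ^ 2 then pairStructureFactor dWaveFormFactor L ψ m else 0 := by
  obtain ⟨hmem, -, heig⟩ := hψ
  have hch := chord_div_le_re_expect_of_eigen (hubbardTorus 2 L 1 U)
    (∑ m : TorusSite 2 L, if momentumNormSq L m ≤ ε ^ 2 then
        ((L : ℂ) ^ 2)⁻¹ • ((pairFieldAt dWaveFormFactor L m)ᴴ * pairFieldAt dWaveFormFactor L m)
        else 0) (szSector N 0) hlam hmem hψ1 heig
  rw [re_expect_window, div_le_iff₀ hlam] at hch
  -- `λ a L² ≤ gap ≤ (window) · λ`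
  have h : lam * (a * (L : ℝ) ^ 2) ≤ lam * ∑ m : TorusSite 2 L,
      if momentumNormSq L m ≤ ε ^ 2 then pairStructureFactor dWaveFormFactor L ψ m else 0 := by
    rw [← mul_assoc]
    linarith
  exact le_of_mul_le_mul_left h hlam

/-- **Composition (kernel-checked): the two stubs imply the crux BY NAME** — the registered shape
`theorem NoNormalLimitState_of : NoNormalLimitState`, sorry-free outside the two `stub_*`. Take `δ`
from stub 1; given `U₀`, stub 1 gives `U ∈ (0,U₀)`, `a > 0` and, for each `ε`, a window gap at all
large even `L`; for an admissible family the sandwich (`windowFloor_of_gap`) turns the gap into the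
window floor `Σ_{|q_m|≤ε} S_L(m) ≥ a L²` of every ground state, and stub 2 turns the floors at every
scale into the atom `≥ a > 0` of every pointwise limit. [folklore] -/
theorem NoNormalLimitState_of :
    Summit.HubbardSuperconductivity.HubbardSuperconductivity.Theses.InfiniteVolumeFirst.NoNormalLimitState := by
  obtain ⟨δ, hδ, hU⟩ := stub_windowGapCofinal
  refine ⟨δ, hδ, fun U₀ hU₀ => ?_⟩
  obtain ⟨U, hU, a, ha, hgap⟩ := hU U₀ hU₀
  refine ⟨U, hU, fun N ψ hadm Ls C hLs hev hconv => ?_⟩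
  have hnorm : ∀ L, Even L → star (ψ L) ⬝ᵥ ψ L = 1 := fun L hL => (hadm L hL).2.1
  have hfloor : ∀ ε : ℝ, 0 < ε → ∃ L₀ : ℕ, ∀ (L : ℕ) [NeZero L], Even L → L₀ ≤ L →
      a * (L : ℝ) ^ 2 ≤ ∑ m : TorusSite 2 L, if momentumNormSq L m ≤ ε ^ 2 then
        pairStructureFactor dWaveFormFactor L (ψ L) m else 0 := by
    intro ε hε
    obtain ⟨lam, hlam, L₀, hL₀⟩ := hgap ε hε
    refine ⟨L₀, fun L _ hLe hLge => ?_⟩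
    obtain ⟨hN, hψ1, hgs⟩ := hadm L hLe
    rw [hN] at hgs
    exact windowFloor_of_gap L U hlam _ hψ1 hgs (hL₀ L hLe hLge)
  exact lt_of_lt_of_le ha (stub_windowFloorAtom ψ a ha hnorm hfloor Ls C hLs hev hconv)

end Summit.HubbardSuperconductivity.HubbardSuperconductivity.Cruxes.NoNormalLimitState.WindowGapTransfer

end
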